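import Summits.Ventures.YMGap.RobustBall.OneState
import Summits.Ventures.YMGap.RobustBall.MassGapOnBallZdGRows
import HarnessLib

/-!
# Venture YMGap, track ROBUST-BALL — ONE STATE on the robust vertex-star rows: the unique DLR state of every member
# of the gauge-invariant `ℤ⁴` ball IS its torus limit, massive AND area-law, up to `β_W = 1/3`

HONEST FRAMING. WHAT THIS IS: a venture file (cell `pub-ymgap`, track Y2 ROBUST-BALL, seat ds-3): the ONE-STATE
theorem `oneState_onBallZdG` (`OneState.lean`) fed with ds-2's robust vertex-star rows on `ℤ⁴`
(`MassGapOnBallZdGRows.lean`, hypothesis-free) and rb-p2's area law uniform on `0 ≤ β_W ≤ 1/3` on the torus ball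
`(3/10, 3/20)` (`su2_areaLawOnBallUpTo_oneThird`), which contains every star cell's radii. CELLS (`SU(2)`, `d = 4`,
Wilson `β_W`, gauge-invariant tier-1 ball `MemBallZdG (2ε) ε R`): `(1/8, .148)`, `(1/6, .112)`, `(1/5, .087)`,
`(1/4, .055)`, `(3/10, .028)`, `(1/3, .012)`, and the UP-TO form on `(3/125, 3/250)` for every `0 ≤ β_W ≤ 1/3`: for
every member, ONE probability measure is at once the unique DLR state and the infinite-volume limit of the member's
PERIODISED torus states along every convergent subsequence; it is an Osterwalder–Seiler massive state with
plaquette–plaquette decay AND obeys Wilson's area law `|⟨W(R'×T)⟩| ≤ C^{2(R'+T)} e^{−cR'T}`; for each range `R` one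
pair `(C, c)`, `c > 0`, serves every member of range `≤ R` (slab window `2R + 1`). WHAT IT IS NOT: existence of the
string tension of the state is not claimed; strong-coupling lattice statements; nothing about the continuum limit or
the Clay Millennium problem.

References: ds-2 `MassGapOnBallZdGRows.lean`, `RobustStarDoorZd.lean`; rb-p2 `RobustAreaLawUpTo.lean`,
`StringTensionOnBall.lean`; ds-3 `OneState.lean`, `PeriodisedDLR.lean`.
-/

noncomputable section

open MeasureTheory Filter Topology Function Finset
open scoped NNReal
open Literature.Probability.LatticeModels
open Literature.MathematicalPhysics.QuantumLattice hiding torusNorm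
open Literature.MathematicalPhysics.QuantumFieldTheory hiding ZdEdge Site
open Literature.Barriers.QuantumFields (IsMassiveState)

namespace Summit.Ventures.YMGap.RobustBall

/-- **`SU(2)`, `d = 4` ONE-STATE SCHEMA on the star window**: a `MassGapOnBallZdG 4 2 β ε₀ ε₁ R` row at tree coupling
`2β ∈ [0, 1/6]` (i.e. `β_W ≤ 1/3`) on radii inside rb-p2's UpTo area-law ball `(3/10, 3/20)` gives: for each range `R`
one `(C, c)`, `c > 0`, such that every member of `MemBallZdG ε₀ ε₁ R` has ONE state (unique DLR = periodised torus
limit), massive with plaquette–plaquette decay and `HasAreaLawWith μ χ₂ C c`. [folklore] -/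
theorem su2_oneState_of_star_row {β ε₀ ε₁ : ℝ} {R : ℕ} (hε₀ : 0 ≤ ε₀) (hε₁ : 0 ≤ ε₁) (h₀ : ε₀ ≤ 3 / 10)
    (h₁ : ε₁ ≤ 3 / 20) (hβ0 : 0 ≤ ((2 : ℕ) : ℝ) * β) (hβ : ((2 : ℕ) : ℝ) * β ≤ 1 / 6)
    (hgap : MassGapOnBallZdG 4 2 β ε₀ ε₁ R) :
    ∃ C c : ℝ, 0 < c ∧ ∀ (W : Potential (ZdEdge 4) (SUN 2)) (supp : Finset (ZdEdge 4) → Finset (Finset (ZdEdge 4)))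
      (hmem : MemBallZdG ε₀ ε₁ R W supp) (hdep : ∀ X, DependsOn (W X) (↑X : Set (ZdEdge 4)))
      (hg : ∀ X, IsZdGaugeInvariant (W X)) (hm : ∀ X, Measurable (W X)) (hb : ∀ X, ∃ C, ∀ U, |W X U| ≤ C),
      ∃ μ : Measure (LGConfig 4 (SUN 2)),
        perturbedGibbsMeasures (d := 4) (fundamentalRep (Fin 2)) (((2 : ℕ) : ℝ) * β) W supp = {μ} ∧
        perturbedLimitPoints (((2 : ℕ) : ℝ) * β) (periodisedFamily W supp hdep hg hm hb) = {μ} ∧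
        IsMassiveState μ ∧ HasExponentialDecay (plaquetteCorrFn (fundamentalRep (Fin 2)) μ) ∧
        HasAreaLawWith μ (fun g => normalisedCharacter 2 (fundamentalRep (Fin 2) g)) C c :=
  oneState_onBallZdG (N := 2) (by norm_num) hε₀ hε₁ hgap
    ((areaLawOnBall_of_upTo (su2_areaLawOnBallUpTo_oneThird R (mv := 2 * R + 1) (by omega)) hβ0 hβ).anti h₀ h₁
      le_rfl le_rfl)

/-- ★ **`SU(2)`, `ℤ⁴`, `β_W = 1/8`, star radius `.148`, HYPOTHESIS-FREE**: every member of `MemBallZdG 0.296 0.148 R`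
(oscillation load `≤ .296`, site-incidence Lipschitz load `≤ .148`, range `R`) has ONE state — unique DLR state = limit of
its PERIODISED torus states — massive with plaquette–plaquette decay AND area-law (for each `R` one `(C, c)`)
(ds-2's `su2_massGapOnBallZdG_star_oneEighth` × rb-p2's UpTo area law). [folklore] -/
theorem su2_oneState_star_oneEighth (R : ℕ) :
    ∃ C c : ℝ, 0 < c ∧ ∀ (W : Potential (ZdEdge 4) (SUN 2)) (supp : Finset (ZdEdge 4) → Finset (Finset (ZdEdge 4)))
      (hmem : MemBallZdG (37 / 125) (37 / 250) R W supp) (hdep : ∀ X, DependsOn (W X) (↑X : Set (ZdEdge 4)))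
      (hg : ∀ X, IsZdGaugeInvariant (W X)) (hm : ∀ X, Measurable (W X)) (hb : ∀ X, ∃ C, ∀ U, |W X U| ≤ C),
      ∃ μ : Measure (LGConfig 4 (SUN 2)),
        perturbedGibbsMeasures (d := 4) (fundamentalRep (Fin 2)) (((2 : ℕ) : ℝ) * (1 / 32)) W supp = {μ} ∧
        perturbedLimitPoints (((2 : ℕ) : ℝ) * (1 / 32)) (periodisedFamily W supp hdep hg hm hb) = {μ} ∧
        IsMassiveState μ ∧ HasExponentialDecay (plaquetteCorrFn (fundamentalRep (Fin 2)) μ) ∧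
        HasAreaLawWith μ (fun g => normalisedCharacter 2 (fundamentalRep (Fin 2) g)) C c :=
  su2_oneState_of_star_row (by norm_num) (by norm_num) (by norm_num) (by norm_num) (by norm_num) (by norm_num)
    (su2_massGapOnBallZdG_star_oneEighth R)

/-- **`SU(2)`, `ℤ⁴`, `β_W = 1/6`, star radius `.112`**: ONE state, massive and area-law, on `MemBallZdG 0.224 0.112 R`
('t Hooft `1/24`). [folklore] -/
theorem su2_oneState_star_oneSixth (R : ℕ) :
    ∃ C c : ℝ, 0 < c ∧ ∀ (W : Potential (ZdEdge 4) (SUN 2)) (supp : Finset (ZdEdge 4) → Finset (Finset (ZdEdge 4)))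
      (hmem : MemBallZdG (28 / 125) (14 / 125) R W supp) (hdep : ∀ X, DependsOn (W X) (↑X : Set (ZdEdge 4)))
      (hg : ∀ X, IsZdGaugeInvariant (W X)) (hm : ∀ X, Measurable (W X)) (hb : ∀ X, ∃ C, ∀ U, |W X U| ≤ C),
      ∃ μ : Measure (LGConfig 4 (SUN 2)),
        perturbedGibbsMeasures (d := 4) (fundamentalRep (Fin 2)) (((2 : ℕ) : ℝ) * (1 / 24)) W supp = {μ} ∧
        perturbedLimitPoints (((2 : ℕ) : ℝ) * (1 / 24)) (periodisedFamily W supp hdep hg hm hb) = {μ} ∧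
        IsMassiveState μ ∧ HasExponentialDecay (plaquetteCorrFn (fundamentalRep (Fin 2)) μ) ∧
        HasAreaLawWith μ (fun g => normalisedCharacter 2 (fundamentalRep (Fin 2) g)) C c :=
  su2_oneState_of_star_row (by norm_num) (by norm_num) (by norm_num) (by norm_num) (by norm_num) (by norm_num)
    (su2_massGapOnBallZdG_star_oneSixth R)

/-- **`SU(2)`, `ℤ⁴`, `β_W = 1/5`, star radius `.087`**: ONE state, massive and area-law, on `MemBallZdG 0.174 0.087 R`
('t Hooft `1/20`). [folklore] -/
theorem su2_oneState_star_oneFifth (R : ℕ) :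
    ∃ C c : ℝ, 0 < c ∧ ∀ (W : Potential (ZdEdge 4) (SUN 2)) (supp : Finset (ZdEdge 4) → Finset (Finset (ZdEdge 4)))
      (hmem : MemBallZdG (87 / 500) (87 / 1000) R W supp) (hdep : ∀ X, DependsOn (W X) (↑X : Set (ZdEdge 4)))
      (hg : ∀ X, IsZdGaugeInvariant (W X)) (hm : ∀ X, Measurable (W X)) (hb : ∀ X, ∃ C, ∀ U, |W X U| ≤ C),
      ∃ μ : Measure (LGConfig 4 (SUN 2)),
        perturbedGibbsMeasures (d := 4) (fundamentalRep (Fin 2)) (((2 : ℕ) : ℝ) * (1 / 20)) W supp = {μ} ∧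
        perturbedLimitPoints (((2 : ℕ) : ℝ) * (1 / 20)) (periodisedFamily W supp hdep hg hm hb) = {μ} ∧
        IsMassiveState μ ∧ HasExponentialDecay (plaquetteCorrFn (fundamentalRep (Fin 2)) μ) ∧
        HasAreaLawWith μ (fun g => normalisedCharacter 2 (fundamentalRep (Fin 2) g)) C c :=
  su2_oneState_of_star_row (by norm_num) (by norm_num) (by norm_num) (by norm_num) (by norm_num) (by norm_num)
    (su2_massGapOnBallZdG_star_oneFifth R)

/-- ★ **`SU(2)`, `ℤ⁴`, `β_W = 1/4`, star radius `.055`**: ONE state, massive and area-law, on `MemBallZdG 0.11 0.055 R`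
('t Hooft `1/16`) — beyond the single-link / pair doors. [folklore] -/
theorem su2_oneState_star_oneQuarter (R : ℕ) :
    ∃ C c : ℝ, 0 < c ∧ ∀ (W : Potential (ZdEdge 4) (SUN 2)) (supp : Finset (ZdEdge 4) → Finset (Finset (ZdEdge 4)))
      (hmem : MemBallZdG (11 / 100) (11 / 200) R W supp) (hdep : ∀ X, DependsOn (W X) (↑X : Set (ZdEdge 4)))
      (hg : ∀ X, IsZdGaugeInvariant (W X)) (hm : ∀ X, Measurable (W X)) (hb : ∀ X, ∃ C, ∀ U, |W X U| ≤ C),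
      ∃ μ : Measure (LGConfig 4 (SUN 2)),
        perturbedGibbsMeasures (d := 4) (fundamentalRep (Fin 2)) (((2 : ℕ) : ℝ) * (1 / 16)) W supp = {μ} ∧
        perturbedLimitPoints (((2 : ℕ) : ℝ) * (1 / 16)) (periodisedFamily W supp hdep hg hm hb) = {μ} ∧
        IsMassiveState μ ∧ HasExponentialDecay (plaquetteCorrFn (fundamentalRep (Fin 2)) μ) ∧
        HasAreaLawWith μ (fun g => normalisedCharacter 2 (fundamentalRep (Fin 2) g)) C c :=
  su2_oneState_of_star_row (by norm_num) (by norm_num) (by norm_num) (by norm_num) (by norm_num) (by norm_num)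
    (su2_massGapOnBallZdG_star_oneQuarter R)

/-- **`SU(2)`, `ℤ⁴`, `β_W = 3/10`, star radius `.028`**: ONE state, massive and area-law, on `MemBallZdG 0.056 0.028 R`
('t Hooft `3/40`). [folklore] -/
theorem su2_oneState_star_threeTenths (R : ℕ) :
    ∃ C c : ℝ, 0 < c ∧ ∀ (W : Potential (ZdEdge 4) (SUN 2)) (supp : Finset (ZdEdge 4) → Finset (Finset (ZdEdge 4)))
      (hmem : MemBallZdG (7 / 125) (7 / 250) R W supp) (hdep : ∀ X, DependsOn (W X) (↑X : Set (ZdEdge 4)))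
      (hg : ∀ X, IsZdGaugeInvariant (W X)) (hm : ∀ X, Measurable (W X)) (hb : ∀ X, ∃ C, ∀ U, |W X U| ≤ C),
      ∃ μ : Measure (LGConfig 4 (SUN 2)),
        perturbedGibbsMeasures (d := 4) (fundamentalRep (Fin 2)) (((2 : ℕ) : ℝ) * (3 / 40)) W supp = {μ} ∧
        perturbedLimitPoints (((2 : ℕ) : ℝ) * (3 / 40)) (periodisedFamily W supp hdep hg hm hb) = {μ} ∧
        IsMassiveState μ ∧ HasExponentialDecay (plaquetteCorrFn (fundamentalRep (Fin 2)) μ) ∧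
        HasAreaLawWith μ (fun g => normalisedCharacter 2 (fundamentalRep (Fin 2) g)) C c :=
  su2_oneState_of_star_row (by norm_num) (by norm_num) (by norm_num) (by norm_num) (by norm_num) (by norm_num)
    (su2_massGapOnBallZdG_star_threeTenths R)

/-- ★★ **`SU(2)`, `ℤ⁴`, `β_W = 1/3`, star radius `.012`, HYPOTHESIS-FREE** — the top of the certified star window:
every member of `MemBallZdG 0.024 0.012 R` has ONE state (unique DLR state = limit of its PERIODISED torus states),
massive with plaquette–plaquette decay AND area-law, for each `R` one `(C, c)` ('t Hooft `1/12`). [folklore] -/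
theorem su2_oneState_star_oneThird (R : ℕ) :
    ∃ C c : ℝ, 0 < c ∧ ∀ (W : Potential (ZdEdge 4) (SUN 2)) (supp : Finset (ZdEdge 4) → Finset (Finset (ZdEdge 4)))
      (hmem : MemBallZdG (3 / 125) (3 / 250) R W supp) (hdep : ∀ X, DependsOn (W X) (↑X : Set (ZdEdge 4)))
      (hg : ∀ X, IsZdGaugeInvariant (W X)) (hm : ∀ X, Measurable (W X)) (hb : ∀ X, ∃ C, ∀ U, |W X U| ≤ C),
      ∃ μ : Measure (LGConfig 4 (SUN 2)),
        perturbedGibbsMeasures (d := 4) (fundamentalRep (Fin 2)) (((2 : ℕ) : ℝ) * (1 / 12)) W supp = {μ} ∧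
        perturbedLimitPoints (((2 : ℕ) : ℝ) * (1 / 12)) (periodisedFamily W supp hdep hg hm hb) = {μ} ∧
        IsMassiveState μ ∧ HasExponentialDecay (plaquetteCorrFn (fundamentalRep (Fin 2)) μ) ∧
        HasAreaLawWith μ (fun g => normalisedCharacter 2 (fundamentalRep (Fin 2) g)) C c :=
  su2_oneState_of_star_row (by norm_num) (by norm_num) (by norm_num) (by norm_num) (by norm_num) (by norm_num)
    (su2_massGapOnBallZdG_star_oneThird R)

/-- ★ **UP TO `β_W = 1/3`**: on `MemBallZdG 0.024 0.012 R`, for EVERY Wilson coupling `0 ≤ β_W ≤ 1/3` ('t Hooft `β_W/4`):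
ONE state, massive and area-law, for each `R` one `(C, c)` INDEPENDENT of `β_W` in the window (ds-2's
`su2_massGapOnBallZdG_star_upTo_oneThird` × rb-p2's UpTo area law). [folklore] -/
theorem su2_oneState_star_upTo_oneThird (R : ℕ) :
    ∃ C c : ℝ, 0 < c ∧ ∀ βW : ℝ, 0 ≤ βW → βW ≤ 1 / 3 →
      ∀ (W : Potential (ZdEdge 4) (SUN 2)) (supp : Finset (ZdEdge 4) → Finset (Finset (ZdEdge 4)))
      (hmem : MemBallZdG (3 / 125) (3 / 250) R W supp) (hdep : ∀ X, DependsOn (W X) (↑X : Set (ZdEdge 4)))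
      (hg : ∀ X, IsZdGaugeInvariant (W X)) (hm : ∀ X, Measurable (W X)) (hb : ∀ X, ∃ C, ∀ U, |W X U| ≤ C),
      ∃ μ : Measure (LGConfig 4 (SUN 2)),
        perturbedGibbsMeasures (d := 4) (fundamentalRep (Fin 2)) (((2 : ℕ) : ℝ) * (βW / 4)) W supp = {μ} ∧
        perturbedLimitPoints (((2 : ℕ) : ℝ) * (βW / 4)) (periodisedFamily W supp hdep hg hm hb) = {μ} ∧
        IsMassiveState μ ∧ HasExponentialDecay (plaquetteCorrFn (fundamentalRep (Fin 2)) μ) ∧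
        HasAreaLawWith μ (fun g => normalisedCharacter 2 (fundamentalRep (Fin 2) g)) C c := by
  obtain ⟨C, c, hc, hA⟩ := su2_stringTension_onBallUpTo_oneThird R (mv := 2 * R + 1) (by omega)
  refine ⟨C, c, hc, fun βW h0 h W supp hmem hdep hg hm hb => ?_⟩
  obtain ⟨μ, hG, hL, hM, hD⟩ := oneState_of_perturbedMassGapAt (N := 2) (by norm_num) hmem
    (su2_massGapOnBallZdG_star_upTo_oneThird h0 h R W supp hmem) hdep hg hm hb
  refine ⟨μ, hG, hL, hM, hD, ?_⟩
  have hev := (MemBallZdG.eventually_periodisedFamily (n := 3) hmem (by norm_num) (by norm_num) hdep hg hm hb).mono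
    fun L hL' => And.intro (clusterDomainFR_mono (ε₀' := 3 / 10) (ε₁' := 3 / 20) (by norm_num) (by norm_num) hL'.1) hL'.2
  exact (hA (((2 : ℕ) : ℝ) * (βW / 4)) (by positivity) (by push_cast; linarith) _ hev μ
    (by rw [hL]; exact Set.mem_singleton μ)).1

end Summit.Ventures.YMGap.RobustBall

end
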